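import Summits.QuantumFields.BalabanUV.T4Continuum.Support.CovariantVectorCoercive
import Summits.QuantumFields.BalabanUV.T4Continuum.Support.ScalarCovariantCTDefects

/-!
# T⁴ programme, SUBSTRATE (shared lattice-gauge analysis library) — `n`-UNIFORM COMBES–THOMAS ROW DEFECTS OF THE COVARIANT VECTOR
# OPERATOR `V_R = Δ_R + a′n^dQ_k(R)ᴴQ_k(R)` for a bond weight lifted to colour: `defect ≤ Jvec (card o) d a′ α τ κ L` — the vector analogue of
# `ScalarCovariantCTDefects` (junction J-2 of MAP v0.4 §O1 O-3′)

Substrate cell `b2b-balaban-substrate-*`, seat p3.  Weight `ρv ρ ((x,μ),a) = ρ (x,μ)` for a bond weight `ρ` on `Tor (fine n M) × Fin d` that is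
`1/n`-Lipschitz along fine bonds (`|ρ(x + e_ν, μ) − ρ(x, μ)| ≤ 1/n`) and oscillates by `≤ L` on the extended block stencils of the averaging
(`DeltaACombesThomas.ctRowDefect_QvAdj_QvOp_le`'s hypothesis; `DeltaACombesThomasSets.stencil_osc_of_lipschitz` gives `L = 2(d+1)`):
 * §1 generic pieces on `(Tor (fine n M) × Fin d) × o` ([folklore]): `ctRowDefect_siteDiagV_eq_zero` (site-diagonal kernels have no defect),
   `siteMul_kronShiftM_apply`, `ctRowDefect_siteMul_kronShiftM_le` ∕ `_adj_le` (`≤ card o·V·(cosh κℓ − 1)`), `ctRowDefect_finset_sum_le`;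
 * §2 the Laplacian: `covDc_sq_eq` (`(∇^R_ν)ᴴ∇^R_ν = |c|²·(siteMul((RᴴR)∘τ⁻¹) + 1 − D_νS_ν − (D_νS_ν)ᴴ)`), `norm_R_le'` (`‖R_ν‖ ≤ 1 + α/n` from
   `‖n(R − 1)‖ ≤ α`), **`ctRowDefect_covLapC_le`**: `defect(Δ_R) ≤ card o·d·(1+α)·κ²·e^{κ²/2}` (via `sq_mul_cosh_div_sub_one_le`);
 * §3 the mass: `norm_Qcov_apply_le` (`‖Q_k(R)(b,i)‖ ≤ (1+τ)·qr(b₁,i₁)`), **`ctRowDefect_mass_le`**: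
   `defect(a′n^d·Q_k(R)ᴴQ_k(R)) ≤ a′·(card o)²·(1+τ)²·(cosh(κL) − 1)` (the `n^d` against the column sums `n^{−d}` of `qr`);
 * §4 **`Jvec co d a′ α τ κ L`** and **`ctRowDefect_vecOp_le`**: `defect(V_R) ≤ Jvec` — FREE OF `n` AND OF THE TORUS; `Jvec_nonneg`, `Jvec_zero`.

HONEST FRAMING (T4-DAG p. 1).  MODEL-level linear algebra ([folklore]; constants OURS and crude); nothing printed is a hypothesis; no
`def … : Prop`; spine 0/9 unchanged; NOT infinite volume ∕ mass gap ∕ Clay.  HONEST DEPENDENCY: continuum YM on T⁴ ⇐ BetaPertH ∧ nine spine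
estimates (0/9 proved); BetaPertH ⇐ (D1) ∧ (D4) ∧ CAP+tail; G-an2-4 gates asym, D1 and NE2/3/4.  ABSOLUTE RULE kept; no `sorry`.
-/

noncomputable section

open scoped BigOperators ComplexConjugate Matrix Matrix.Norms.L2Operator Kronecker ComplexOrder

namespace Summit.QuantumFields.BalabanUV.T4Continuum.CovariantVectorCTDefects

open Literature.MathematicalPhysics.QuantumFieldTheory.Balaban1983to89.B5Prop11Plancherel (Tor fine unitVec shiftM)
open Literature.MathematicalPhysics.QuantumFieldTheory.Balaban1983to89.B5Block118 (QvOp bpt tstep)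
open Literature.MathematicalPhysics.QuantumFieldTheory.Balaban1983to89.Beta.DeltaACombesThomas (ctWeight ctRowDefect ctWeight_nonneg ctWeight_self
  ctRowDefect_nonneg ctRowDefect_add_le ctRowDefect_smul ctRowDefect_le_of_norm_le shiftM_apply shiftEquiv_apply sq_mul_cosh_div_sub_one_le
  qr qr_nonneg qr_ne_zero norm_QvOp_le sum_qr_row sum_qr_col)
open Summit.QuantumFields.BalabanUV.T4Continuum
open Summit.QuantumFields.BalabanUV.T4Continuum.KroneckerLift
open Summit.QuantumFields.BalabanUV.T4Continuum.BlockMultiplication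
open Summit.QuantumFields.BalabanUV.T4Continuum.KroneckerUnits (norm_entry_le)
open Summit.QuantumFields.BalabanUV.T4Continuum.AbelianCovariantLaplacian (tauInv)
open Summit.QuantumFields.BalabanUV.T4Continuum.ColourCovariantLaplacian (covDc connM covLapC siteMul_shift_sq)
open Summit.QuantumFields.BalabanUV.T4Continuum.CovariantBlockAveraging (transport ContourSystem Qcov Qcov_sub_kron_apply norm_Qcov_sub_kron_apply_le)
open Summit.QuantumFields.BalabanUV.T4Continuum.ScalarCovariantCTDefects (ctWeight_le_of_abs_le)
open Summit.QuantumFields.BalabanUV.T4Continuum.CovariantVectorCoercive (vecOp)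

variable {d : ℕ} {o : Type*} [Fintype o] [DecidableEq o]
variable (n : ℕ) [NeZero n] (M : Fin d → ℕ) [hM : ∀ μ, NeZero (M μ)]

/-- the bond weight lifted to colour: `ρv ρ ((x,μ),a) = ρ (x,μ)`. [folklore] -/
abbrev rhoV (ρ : Tor (fine n M) × Fin d → ℝ) : (Tor (fine n M) × Fin d) × o → ℝ := fun i => ρ i.1

variable {ρ : Tor (fine n M) × Fin d → ℝ} {κ : ℝ}

/-! ## §1 Generic pieces -/

omit [DecidableEq o] in
/-- a kernel that is diagonal in the bond index (`A i j = 0` unless `i.1 = j.1`) has no row defect for a weight depending on the bond only.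
[folklore] -/
theorem ctRowDefect_siteDiagV_eq_zero (A : Matrix ((Tor (fine n M) × Fin d) × o) ((Tor (fine n M) × Fin d) × o) ℂ)
    (hA : ∀ i j, i.1 ≠ j.1 → A i j = 0) (κ : ℝ) (ρ : Tor (fine n M) × Fin d → ℝ) (i : (Tor (fine n M) × Fin d) × o) :
    ctRowDefect A κ (rhoV n M ρ) i = 0 := by
  refine Finset.sum_eq_zero fun j _ => ?_
  by_cases h : i.1 = j.1
  · rw [ctWeight, show rhoV n M (o := o) ρ i = rhoV n M ρ j from by simp only [rhoV, h], sub_self, mul_zero, Real.cosh_zero, sub_self, mul_zero]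
  · rw [hA i j h, norm_zero, zero_mul]

omit [DecidableEq o] in
/-- `siteMul w` has no row defect. [folklore] -/
theorem ctRowDefect_siteMul_eq_zero (w : Tor (fine n M) × Fin d → Matrix o o ℂ) (κ : ℝ) (ρ : Tor (fine n M) × Fin d → ℝ)
    (i : (Tor (fine n M) × Fin d) × o) : ctRowDefect (siteMul w) κ (rhoV n M ρ) i = 0 :=
  ctRowDefect_siteDiagV_eq_zero n M _ (fun i j h => by rw [siteMul_apply, if_neg h]) κ ρ i

/-- `1` has no row defect. [folklore] -/
theorem ctRowDefect_one_eq_zero (κ : ℝ) (ρ : Tor (fine n M) × Fin d → ℝ) (i : (Tor (fine n M) × Fin d) × o) :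
    ctRowDefect (1 : Matrix ((Tor (fine n M) × Fin d) × o) ((Tor (fine n M) × Fin d) × o) ℂ) κ (rhoV n M ρ) i = 0 :=
  ctRowDefect_siteDiagV_eq_zero n M _ (fun i j h => Matrix.one_apply_ne fun hij => h (by rw [hij])) κ ρ i

/-- entries of the transported vector shift: `(siteMul v·(S_ν ⊗ 1))(((x,μ),a), ((x′,μ′),a′)) = [(x′,μ′) = (x + e_ν, μ)]·v(x,μ)_{aa′}`. [folklore] -/
theorem siteMul_kronShiftM_apply (v : Tor (fine n M) × Fin d → Matrix o o ℂ) (ν : Fin d) (i j : (Tor (fine n M) × Fin d) × o) :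
    (siteMul v * shiftM (fine n M) ν ⊗ₖ (1 : Matrix o o ℂ)) i j = if j.1 = (i.1.1 + unitVec (fine n M) ν, i.1.2) then v i.1 i.2 j.2 else 0 := by
  rw [siteMul_mul_kron_apply, shiftM_apply, shiftEquiv_apply]
  split_ifs <;> simp

/-- **row defect of the transported vector shift**: `≤ card o·V·(cosh κℓ − 1)` for an `ℓ`-Lipschitz bond weight and `‖v‖ ≤ V`. [folklore] -/
theorem ctRowDefect_siteMul_kronShiftM_le (v : Tor (fine n M) × Fin d → Matrix o o ℂ) (ν : Fin d) {ℓ V : ℝ} (hV : 0 ≤ V)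
    (hlip : ∀ x μ ν', |ρ (x + unitVec (fine n M) ν', μ) - ρ (x, μ)| ≤ ℓ) (hv : ∀ k, ‖v k‖ ≤ V) (i : (Tor (fine n M) × Fin d) × o) :
    ctRowDefect (siteMul v * shiftM (fine n M) ν ⊗ₖ (1 : Matrix o o ℂ)) κ (rhoV n M ρ) i ≤ Fintype.card o * V * (Real.cosh (κ * ℓ) - 1) := by
  calc ctRowDefect (siteMul v * shiftM (fine n M) ν ⊗ₖ (1 : Matrix o o ℂ)) κ (rhoV n M ρ) i
      ≤ ∑ j : (Tor (fine n M) × Fin d) × o, (if j.1 = (i.1.1 + unitVec (fine n M) ν, i.1.2) then V else 0) * ctWeight κ (rhoV n M ρ) i j := by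
        refine ctRowDefect_le_of_norm_le (siteMul v * shiftM (fine n M) ν ⊗ₖ (1 : Matrix o o ℂ))
          (fun i₁ j => if j.1 = (i₁.1.1 + unitVec (fine n M) ν, i₁.1.2) then V else 0) κ (rhoV n M ρ) i fun j => ?_
        rw [siteMul_kronShiftM_apply]
        split_ifs
        · exact (norm_entry_le _ _ _).trans (hv i.1)
        · rw [norm_zero]
    _ = ∑ a' : o, V * ctWeight κ (rhoV n M ρ) i ((i.1.1 + unitVec (fine n M) ν, i.1.2), a') := by
        rw [Fintype.sum_prod_type, Finset.sum_eq_single (i.1.1 + unitVec (fine n M) ν, i.1.2)]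
        · simp
        · intro x _ hx; simp [hx]
        · intro h; exact absurd (Finset.mem_univ _) h
    _ ≤ ∑ _a' : o, V * (Real.cosh (κ * ℓ) - 1) := by
        refine Finset.sum_le_sum fun a' _ => mul_le_mul_of_nonneg_left (ctWeight_le_of_abs_le κ _ ?_) hV
        simp only [rhoV]
        rw [abs_sub_comm]
        have h := hlip i.1.1 i.1.2 ν
        exact h
    _ = Fintype.card o * V * (Real.cosh (κ * ℓ) - 1) := by rw [Finset.sum_const, Finset.card_univ, nsmul_eq_mul]; ring

/-- **row defect of the adjoint transported vector shift** (entries at `x′ = x − e_ν`). [folklore] -/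
theorem ctRowDefect_siteMul_kronShiftM_adj_le (v : Tor (fine n M) × Fin d → Matrix o o ℂ) (ν : Fin d) {ℓ V : ℝ} (hV : 0 ≤ V)
    (hlip : ∀ x μ ν', |ρ (x + unitVec (fine n M) ν', μ) - ρ (x, μ)| ≤ ℓ) (hv : ∀ k, ‖v k‖ ≤ V) (i : (Tor (fine n M) × Fin d) × o) :
    ctRowDefect (siteMul v * shiftM (fine n M) ν ⊗ₖ (1 : Matrix o o ℂ))ᴴ κ (rhoV n M ρ) i ≤ Fintype.card o * V * (Real.cosh (κ * ℓ) - 1) := by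
  calc ctRowDefect (siteMul v * shiftM (fine n M) ν ⊗ₖ (1 : Matrix o o ℂ))ᴴ κ (rhoV n M ρ) i
      ≤ ∑ j : (Tor (fine n M) × Fin d) × o, (if j.1 = (i.1.1 - unitVec (fine n M) ν, i.1.2) then V else 0) * ctWeight κ (rhoV n M ρ) i j := by
        refine ctRowDefect_le_of_norm_le (siteMul v * shiftM (fine n M) ν ⊗ₖ (1 : Matrix o o ℂ))ᴴ
          (fun i₁ j => if j.1 = (i₁.1.1 - unitVec (fine n M) ν, i₁.1.2) then V else 0) κ (rhoV n M ρ) i fun j => ?_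
        rw [Matrix.conjTranspose_apply, norm_star, siteMul_kronShiftM_apply]
        by_cases h : j.1 = (i.1.1 - unitVec (fine n M) ν, i.1.2)
        · rw [if_pos h]
          split_ifs
          · exact (norm_entry_le _ _ _).trans (hv j.1)
          · rw [norm_zero]; exact hV
        · rw [if_neg h]
          have h' : ¬ i.1 = (j.1.1 + unitVec (fine n M) ν, j.1.2) := by
            intro h'
            apply h
            rw [Prod.ext_iff] at h' ⊢
            exact ⟨by rw [h'.1, add_sub_cancel_right], h'.2.symm⟩
          rw [if_neg h', norm_zero]
    _ = ∑ a' : o, V * ctWeight κ (rhoV n M ρ) i ((i.1.1 - unitVec (fine n M) ν, i.1.2), a') := by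
        rw [Fintype.sum_prod_type, Finset.sum_eq_single (i.1.1 - unitVec (fine n M) ν, i.1.2)]
        · simp
        · intro x _ hx; simp [hx]
        · intro h; exact absurd (Finset.mem_univ _) h
    _ ≤ ∑ _a' : o, V * (Real.cosh (κ * ℓ) - 1) := by
        refine Finset.sum_le_sum fun a' _ => mul_le_mul_of_nonneg_left (ctWeight_le_of_abs_le κ _ ?_) hV
        simp only [rhoV]
        have h := hlip (i.1.1 - unitVec (fine n M) ν) i.1.2 ν
        rw [sub_add_cancel] at h
        rwa [show ((i.1.1, i.1.2) : Tor (fine n M) × Fin d) = i.1 from rfl] at h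
    _ = Fintype.card o * V * (Real.cosh (κ * ℓ) - 1) := by rw [Finset.sum_const, Finset.card_univ, nsmul_eq_mul]; ring

omit [DecidableEq o] [NeZero n] hM in
/-- the row defect of a finite sum is at most the sum of the row defects. [folklore] -/
theorem ctRowDefect_finset_sum_le {ι σ : Type*} [Fintype σ] (s : Finset ι) (A : ι → Matrix σ σ ℂ) (κ : ℝ) (ρ : σ → ℝ) (e : σ) :
    ctRowDefect (∑ x ∈ s, A x) κ ρ e ≤ ∑ x ∈ s, ctRowDefect (A x) κ ρ e := by
  classical
  induction s using Finset.induction_on with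
  | empty => simp [ctRowDefect]
  | insert a s ha ih =>
    rw [Finset.sum_insert ha, Finset.sum_insert ha]
    exact (ctRowDefect_add_le _ _ κ ρ e).trans (add_le_add le_rfl ih)

/-! ## §2 The covariant vector Laplacian -/

section Laplacian

variable {R : Fin d → (Tor (fine n M) × Fin d → Matrix o o ℂ)} {α : ℝ}

omit hM in
/-- `‖R_ν(k)‖ ≤ 1 + α/n` from `‖n(R_ν(k) − 1)‖ ≤ α`. [folklore] -/
theorem norm_R_le' (hR : ∀ ν k, ‖connM (fine n M) ((n : ℕ) : ℂ) R ν k‖ ≤ α) (ν : Fin d) (k : Tor (fine n M) × Fin d) :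
    ‖R ν k‖ ≤ 1 + α / n := by
  have hn : (0 : ℝ) < n := by exact_mod_cast Nat.pos_of_ne_zero (NeZero.ne n)
  have h1 : ‖(1 : Matrix o o ℂ)‖ ≤ 1 := by rw [Matrix.cstar_norm_def, map_one]; exact ContinuousLinearMap.norm_id_le
  have h2 : ‖R ν k - 1‖ ≤ α / n := by
    have h := hR ν k
    rw [connM, norm_smul, Complex.norm_natCast] at h
    rwa [le_div_iff₀ hn, mul_comm]
  calc ‖R ν k‖ = ‖1 + (R ν k - 1)‖ := by rw [add_sub_cancel]
    _ ≤ 1 + α / n := (norm_add_le _ _).trans (add_le_add h1 h2)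

/-- **the per-direction Gram expansion**: `(∇^R_ν)ᴴ∇^R_ν = (c̄c)·(siteMul((RᴴR)∘τ_ν⁻¹) + 1 − D_νS_ν − (D_νS_ν)ᴴ)`, `D_νS_ν = siteMul(R_ν)·(S_ν ⊗ 1)`.
[folklore] -/
theorem covDc_sq_eq (c : ℂ) (R : Fin d → (Tor (fine n M) × Fin d → Matrix o o ℂ)) (ν : Fin d) :
    (covDc (fine n M) c R ν)ᴴ * covDc (fine n M) c R ν
      = (conj c * c) • (siteMul (fun i => (R ν (tauInv (fine n M) ν i))ᴴ * R ν (tauInv (fine n M) ν i)) + 1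
          - siteMul (R ν) * shiftM (fine n M) ν ⊗ₖ (1 : Matrix o o ℂ) - (siteMul (R ν) * shiftM (fine n M) ν ⊗ₖ (1 : Matrix o o ℂ))ᴴ) := by
  set DS := siteMul (R ν) * shiftM (fine n M) ν ⊗ₖ (1 : Matrix o o ℂ) with hDS
  have hsq : DSᴴ * DS = siteMul (fun i => (R ν (tauInv (fine n M) ν i))ᴴ * R ν (tauInv (fine n M) ν i)) := siteMul_shift_sq n M ν (R ν)
  rw [covDc, ← hDS, Matrix.conjTranspose_smul, Matrix.smul_mul, Matrix.mul_smul, smul_smul, Complex.star_def, Matrix.conjTranspose_sub,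
    Matrix.conjTranspose_one, Matrix.sub_mul, Matrix.mul_sub, Matrix.mul_sub, Matrix.one_mul, Matrix.mul_one, Matrix.one_mul, hsq]
  congr 1
  abel

/-- **ROW DEFECT OF THE COVARIANT VECTOR LAPLACIAN**, `n`-uniform: `defect(Δ_R) ≤ card o·d·(1+α)·κ²·e^{κ²/2}` for a `1/n`-Lipschitz bond weight and
`‖n(R − 1)‖ ≤ α`. [folklore] -/
theorem ctRowDefect_covLapC_le (hα : 0 ≤ α) (hR : ∀ ν k, ‖connM (fine n M) ((n : ℕ) : ℂ) R ν k‖ ≤ α)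
    (hlip : ∀ x μ ν', |ρ (x + unitVec (fine n M) ν', μ) - ρ (x, μ)| ≤ 1 / n) (i : (Tor (fine n M) × Fin d) × o) :
    ctRowDefect (covLapC (fine n M) ((n : ℕ) : ℂ) R) κ (rhoV n M ρ) i ≤ Fintype.card o * d * (1 + α) * (κ ^ 2 * Real.exp (κ ^ 2 / 2)) := by
  have hn1 : 1 ≤ n := Nat.one_le_iff_ne_zero.mpr (NeZero.ne n)
  have hn : (0 : ℝ) < n := by exact_mod_cast hn1
  have hV : 0 ≤ 1 + α / n := by positivity
  have hco : (0 : ℝ) ≤ Fintype.card o := Nat.cast_nonneg _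
  have hw0 : 0 ≤ Real.cosh (κ * (1 / n)) - 1 := by linarith [Real.one_le_cosh (κ * (1 / n))]
  -- per direction
  have hdir : ∀ ν, ctRowDefect ((covDc (fine n M) ((n : ℕ) : ℂ) R ν)ᴴ * covDc (fine n M) ((n : ℕ) : ℂ) R ν) κ (rhoV n M ρ) i
      ≤ (n : ℝ) ^ 2 * (2 * (Fintype.card o * (1 + α / n) * (Real.cosh (κ * (1 / n)) - 1))) := by
    intro ν
    rw [covDc_sq_eq, ctRowDefect_smul, norm_mul, Complex.norm_conj, Complex.norm_natCast, ← sq]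
    refine mul_le_mul_of_nonneg_left ?_ (sq_nonneg _)
    set Z : Matrix ((Tor (fine n M) × Fin d) × o) ((Tor (fine n M) × Fin d) × o) ℂ :=
      siteMul (fun i => (R ν (tauInv (fine n M) ν i))ᴴ * R ν (tauInv (fine n M) ν i)) with hZ
    set DS : Matrix ((Tor (fine n M) × Fin d) × o) ((Tor (fine n M) × Fin d) × o) ℂ := siteMul (R ν) * shiftM (fine n M) ν ⊗ₖ (1 : Matrix o o ℂ)
      with hDS
    have hA : ctRowDefect Z κ (rhoV n M ρ) i = 0 := ctRowDefect_siteMul_eq_zero n M _ κ ρ i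
    have hB : ctRowDefect (1 : Matrix ((Tor (fine n M) × Fin d) × o) ((Tor (fine n M) × Fin d) × o) ℂ) κ (rhoV n M ρ) i = 0 :=
      ctRowDefect_one_eq_zero n M κ ρ i
    have hC : ctRowDefect DS κ (rhoV n M ρ) i ≤ Fintype.card o * (1 + α / n) * (Real.cosh (κ * (1 / n)) - 1) :=
      ctRowDefect_siteMul_kronShiftM_le n M (R ν) ν hV hlip (norm_R_le' n M hR ν) i
    have hD : ctRowDefect DSᴴ κ (rhoV n M ρ) i ≤ Fintype.card o * (1 + α / n) * (Real.cosh (κ * (1 / n)) - 1) :=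
      ctRowDefect_siteMul_kronShiftM_adj_le n M (R ν) ν hV hlip (norm_R_le' n M hR ν) i
    have h1 := Literature.MathematicalPhysics.QuantumFieldTheory.Balaban1983to89.Beta.DeltaACombesThomas.ctRowDefect_sub_le (Z + 1 - DS) DSᴴ κ
      (rhoV n M ρ) i
    have h2 := Literature.MathematicalPhysics.QuantumFieldTheory.Balaban1983to89.Beta.DeltaACombesThomas.ctRowDefect_sub_le (Z + 1) DS κ
      (rhoV n M ρ) i
    have h3 := ctRowDefect_add_le Z 1 κ (rhoV n M ρ) i
    linarith
  -- sum over directions and the `n`-uniformity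
  have hcosh := sq_mul_cosh_div_sub_one_le n κ hn1
  have hkey : (n : ℝ) ^ 2 * (2 * (Fintype.card o * (1 + α / n) * (Real.cosh (κ * (1 / n)) - 1)))
      ≤ Fintype.card o * (1 + α) * (κ ^ 2 * Real.exp (κ ^ 2 / 2)) := by
    have e1 : κ * (1 / (n : ℝ)) = κ / n := by ring
    rw [e1]
    have hαn : (n : ℝ) ^ 2 * (1 + α / n) ≤ (1 + α) * (n : ℝ) ^ 2 := by
      rw [show (n : ℝ) ^ 2 * (1 + α / n) = (n : ℝ) ^ 2 + α * n by field_simp]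
      have : α * (n : ℝ) ≤ α * (n : ℝ) ^ 2 := mul_le_mul_of_nonneg_left (by nlinarith [show (1 : ℝ) ≤ n by exact_mod_cast hn1]) hα
      nlinarith
    have hc0 : 0 ≤ Real.cosh (κ / n) - 1 := by linarith [Real.one_le_cosh (κ / n)]
    calc (n : ℝ) ^ 2 * (2 * (Fintype.card o * (1 + α / n) * (Real.cosh (κ / n) - 1)))
        = 2 * Fintype.card o * (((n : ℝ) ^ 2 * (1 + α / n)) * (Real.cosh (κ / n) - 1)) := by ring
      _ ≤ 2 * Fintype.card o * (((1 + α) * (n : ℝ) ^ 2) * (Real.cosh (κ / n) - 1)) := by gcongr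
      _ = 2 * Fintype.card o * (1 + α) * ((n : ℝ) ^ 2 * (Real.cosh (κ / n) - 1)) := by ring
      _ ≤ 2 * Fintype.card o * (1 + α) * (κ ^ 2 / 2 * Real.exp (κ ^ 2 / 2)) := mul_le_mul_of_nonneg_left hcosh (by positivity)
      _ = Fintype.card o * (1 + α) * (κ ^ 2 * Real.exp (κ ^ 2 / 2)) := by ring
  calc ctRowDefect (covLapC (fine n M) ((n : ℕ) : ℂ) R) κ (rhoV n M ρ) i
      ≤ ∑ ν, ctRowDefect ((covDc (fine n M) ((n : ℕ) : ℂ) R ν)ᴴ * covDc (fine n M) ((n : ℕ) : ℂ) R ν) κ (rhoV n M ρ) i :=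
        ctRowDefect_finset_sum_le _ _ κ _ i
    _ ≤ ∑ _ν : Fin d, Fintype.card o * (1 + α) * (κ ^ 2 * Real.exp (κ ^ 2 / 2)) := Finset.sum_le_sum fun ν _ => (hdir ν).trans hkey
    _ = Fintype.card o * d * (1 + α) * (κ ^ 2 * Real.exp (κ ^ 2 / 2)) := by
        rw [Finset.sum_const, Finset.card_univ, Fintype.card_fin, nsmul_eq_mul]; ring

end Laplacian

/-! ## §3 The mass term -/

section Mass

variable {R : Fin d → (Tor (fine n M) × Fin d → Matrix o o ℂ)} {Γ : ContourSystem d n M} {τ : ℝ}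

omit [NeZero n] hM in
/-- **entries of `Q_k(R)`**: `‖Q_k(R)(b, i)‖ ≤ (1 + τ)·qr(b₁, i₁)` when the contour transports satisfy `‖T(Γ) − 1‖ ≤ τ`. [folklore] -/
theorem norm_Qcov_apply_le (hτ : 0 ≤ τ) (hT : ∀ y j μ (t : Fin n), ‖transport (fine n M) R μ (Γ y j μ t) - 1‖ ≤ τ)
    (b : (Tor M × Fin d) × o) (i : (Tor (fine n M) × Fin d) × o) : ‖Qcov n M Γ R b i‖ ≤ (1 + τ) * qr n M b.1 i.1 := by
  have h1 : ‖(Qcov n M Γ R - QvOp n M ⊗ₖ (1 : Matrix o o ℂ)) b i‖ ≤ τ * qr n M b.1 i.1 := norm_Qcov_sub_kron_apply_le n M Γ hτ hT b i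
  have h2 : ‖(QvOp n M ⊗ₖ (1 : Matrix o o ℂ)) b i‖ ≤ qr n M b.1 i.1 := by
    rw [Matrix.kroneckerMap_apply, norm_mul]
    calc ‖QvOp n M b.1 i.1‖ * ‖(1 : Matrix o o ℂ) b.2 i.2‖ ≤ qr n M b.1 i.1 * 1 := by
          refine mul_le_mul (norm_QvOp_le n M b.1 i.1) ?_ (norm_nonneg _) (qr_nonneg n M b.1 i.1)
          rw [Matrix.one_apply]; split_ifs <;> simp
      _ = qr n M b.1 i.1 := mul_one _
  calc ‖Qcov n M Γ R b i‖ = ‖(Qcov n M Γ R - QvOp n M ⊗ₖ (1 : Matrix o o ℂ)) b i + (QvOp n M ⊗ₖ (1 : Matrix o o ℂ)) b i‖ := by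
        rw [Matrix.sub_apply, sub_add_cancel]
    _ ≤ τ * qr n M b.1 i.1 + qr n M b.1 i.1 := (norm_add_le _ _).trans (add_le_add h1 h2)
    _ = (1 + τ) * qr n M b.1 i.1 := by ring

omit [NeZero n] in
/-- entrywise: `‖(Q_k(R)ᴴQ_k(R))(i, i′)‖ ≤ (1+τ)²·card o·Σ_{b₁} qr(b₁,i₁)·qr(b₁,i′₁)`. [folklore] -/
theorem norm_QcovH_Qcov_le (hτ : 0 ≤ τ) (hT : ∀ y j μ (t : Fin n), ‖transport (fine n M) R μ (Γ y j μ t) - 1‖ ≤ τ)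
    (i i' : (Tor (fine n M) × Fin d) × o) :
    ‖((Qcov n M Γ R)ᴴ * Qcov n M Γ R) i i'‖ ≤ (1 + τ) ^ 2 * Fintype.card o * ∑ b₁ : Tor M × Fin d, qr n M b₁ i.1 * qr n M b₁ i'.1 := by
  rw [Matrix.mul_apply]
  calc ‖∑ b, (Qcov n M Γ R)ᴴ i b * Qcov n M Γ R b i'‖ ≤ ∑ b, ‖(Qcov n M Γ R)ᴴ i b * Qcov n M Γ R b i'‖ := norm_sum_le _ _
    _ ≤ ∑ b : (Tor M × Fin d) × o, ((1 + τ) * qr n M b.1 i.1) * ((1 + τ) * qr n M b.1 i'.1) := Finset.sum_le_sum fun b _ => by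
        rw [norm_mul, Matrix.conjTranspose_apply, norm_star]
        exact mul_le_mul (norm_Qcov_apply_le n M hτ hT b i) (norm_Qcov_apply_le n M hτ hT b i') (norm_nonneg _)
          (mul_nonneg (by linarith) (qr_nonneg n M b.1 i.1))
    _ = (1 + τ) ^ 2 * Fintype.card o * ∑ b₁ : Tor M × Fin d, qr n M b₁ i.1 * qr n M b₁ i'.1 := by
        rw [Fintype.sum_prod_type, Finset.mul_sum]
        refine Finset.sum_congr rfl fun b₁ _ => ?_
        dsimp only
        rw [Finset.sum_const, Finset.card_univ, nsmul_eq_mul]; ring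

/-- **ROW DEFECT OF THE MASS TERM** `a′n^d·Q_k(R)ᴴQ_k(R)`: if the bond weight oscillates by `≤ L` over every extended block stencil, then
`defect ≤ a′·(card o)²·(1+τ)²·(cosh(κL) − 1)` — the `n^d` against the column sums `n^{−d}`; free of `n` and of the torus. [folklore] -/
theorem ctRowDefect_mass_le {a' L : ℝ} (ha' : 0 ≤ a') (hτ : 0 ≤ τ) (hT : ∀ y j μ (t : Fin n), ‖transport (fine n M) R μ (Γ y j μ t) - 1‖ ≤ τ)
    (hL : ∀ (y : Tor M) (μ : Fin d) (j j' : Fin d → Fin n) (t t' : Fin n),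
      |ρ (bpt n M y j + tstep (fine n M) μ t, μ) - ρ (bpt n M y j' + tstep (fine n M) μ t', μ)| ≤ L)
    (i : (Tor (fine n M) × Fin d) × o) :
    ctRowDefect (((a' * (n : ℝ) ^ d : ℝ) : ℂ) • ((Qcov n M Γ R)ᴴ * Qcov n M Γ R)) κ (rhoV n M ρ) i
      ≤ a' * (Fintype.card o) ^ 2 * (1 + τ) ^ 2 * (Real.cosh (κ * L) - 1) := by
  set W := Real.cosh (κ * L) - 1 with hWdef
  have hn : (n : ℝ) ≠ 0 := by exact_mod_cast NeZero.ne n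
  have hnd : (0 : ℝ) < (n : ℝ) ^ d := by positivity
  have hco : (0 : ℝ) ≤ Fintype.card o := Nat.cast_nonneg _
  have hW0 : 0 ≤ W := by rw [hWdef]; linarith [Real.one_le_cosh (κ * L)]
  -- on the joint support of `qr(b₁, i₁)`, `qr(b₁, i′₁)` the weight is at most `W`
  have hw : ∀ (b₁ : Tor M × Fin d) (i' : (Tor (fine n M) × Fin d) × o), qr n M b₁ i.1 ≠ 0 → qr n M b₁ i'.1 ≠ 0 →
      ctWeight κ (rhoV n M ρ) i i' ≤ W := by
    intro b₁ i' h h'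
    obtain ⟨j, t, hi⟩ := qr_ne_zero n M b₁ i.1 h
    obtain ⟨j', t', hi'⟩ := qr_ne_zero n M b₁ i'.1 h'
    refine ctWeight_le_of_abs_le κ _ ?_
    simp only [rhoV]
    rw [hi, hi']
    exact hL b₁.1 b₁.2 j j' t t'
  have hterm : ∀ (b₁ : Tor M × Fin d) (i' : (Tor (fine n M) × Fin d) × o),
      qr n M b₁ i.1 * qr n M b₁ i'.1 * ctWeight κ (rhoV n M ρ) i i' ≤ qr n M b₁ i.1 * qr n M b₁ i'.1 * W := by
    intro b₁ i'
    by_cases h : qr n M b₁ i.1 = 0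
    · rw [h]; simp
    by_cases h' : qr n M b₁ i'.1 = 0
    · rw [h']; simp
    exact mul_le_mul_of_nonneg_left (hw b₁ i' h h') (mul_nonneg (qr_nonneg n M b₁ i.1) (qr_nonneg n M b₁ i'.1))
  rw [ctRowDefect_smul, Complex.norm_real, Real.norm_of_nonneg (by positivity)]
  have hsum : ctRowDefect ((Qcov n M Γ R)ᴴ * Qcov n M Γ R) κ (rhoV n M ρ) i ≤ (1 + τ) ^ 2 * (Fintype.card o) ^ 2 * W * ((n : ℝ) ^ d)⁻¹ := by
    calc ctRowDefect ((Qcov n M Γ R)ᴴ * Qcov n M Γ R) κ (rhoV n M ρ) i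
        ≤ ∑ i', ((1 + τ) ^ 2 * Fintype.card o * ∑ b₁ : Tor M × Fin d, qr n M b₁ i.1 * qr n M b₁ i'.1) * ctWeight κ (rhoV n M ρ) i i' :=
          ctRowDefect_le_of_norm_le ((Qcov n M Γ R)ᴴ * Qcov n M Γ R)
            (fun i i' => (1 + τ) ^ 2 * Fintype.card o * ∑ b₁ : Tor M × Fin d, qr n M b₁ i.1 * qr n M b₁ i'.1) κ (rhoV n M ρ) i
            (norm_QcovH_Qcov_le n M hτ hT i)
      _ = (1 + τ) ^ 2 * Fintype.card o
            * ∑ i' : (Tor (fine n M) × Fin d) × o, ∑ b₁ : Tor M × Fin d, qr n M b₁ i.1 * qr n M b₁ i'.1 * ctWeight κ (rhoV n M ρ) i i' := by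
          rw [Finset.mul_sum]
          refine Finset.sum_congr rfl fun i' _ => ?_
          rw [mul_assoc, Finset.sum_mul]
      _ ≤ (1 + τ) ^ 2 * Fintype.card o * ∑ i' : (Tor (fine n M) × Fin d) × o, ∑ b₁ : Tor M × Fin d, qr n M b₁ i.1 * qr n M b₁ i'.1 * W := by
          refine mul_le_mul_of_nonneg_left ?_ (by positivity)
          exact Finset.sum_le_sum fun i' _ => Finset.sum_le_sum fun b₁ _ => hterm b₁ i'
      _ = (1 + τ) ^ 2 * Fintype.card o * W * ∑ b₁ : Tor M × Fin d, qr n M b₁ i.1 * ∑ i' : (Tor (fine n M) × Fin d) × o, qr n M b₁ i'.1 := by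
          rw [Finset.sum_comm]
          simp only [Finset.mul_sum]
          refine Finset.sum_congr rfl fun b₁ _ => Finset.sum_congr rfl fun i' _ => ?_
          ring
      _ = (1 + τ) ^ 2 * Fintype.card o * W * ∑ b₁ : Tor M × Fin d, qr n M b₁ i.1 * Fintype.card o := by
          congr 1
          refine Finset.sum_congr rfl fun b₁ _ => ?_
          congr 1
          rw [Fintype.sum_prod_type]
          simp only [Finset.sum_const, Finset.card_univ, nsmul_eq_mul]
          rw [← Finset.mul_sum, sum_qr_row, mul_one]
      _ = (1 + τ) ^ 2 * (Fintype.card o) ^ 2 * W * ((n : ℝ) ^ d)⁻¹ := by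
          rw [← Finset.sum_mul, sum_qr_col, one_div]; ring
  calc a' * (n : ℝ) ^ d * ctRowDefect ((Qcov n M Γ R)ᴴ * Qcov n M Γ R) κ (rhoV n M ρ) i
      ≤ a' * (n : ℝ) ^ d * ((1 + τ) ^ 2 * (Fintype.card o) ^ 2 * W * ((n : ℝ) ^ d)⁻¹) := mul_le_mul_of_nonneg_left hsum (by positivity)
    _ = a' * (Fintype.card o) ^ 2 * (1 + τ) ^ 2 * W * ((n : ℝ) ^ d * ((n : ℝ) ^ d)⁻¹) := by ring
    _ = a' * (Fintype.card o) ^ 2 * (1 + τ) ^ 2 * W := by rw [mul_inv_cancel₀ hnd.ne', mul_one]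

end Mass

/-! ## §4 The level-free row-defect budget of `V_R` -/

section Budget

/-- **the VECTOR row-defect budget** `Jvec co d a′ α τ κ L = co·d·(1+α)·κ²e^{κ²/2} + a′·co²·(1+τ)²·(cosh(κL) − 1)`. [folklore] -/
def Jvec (co d : ℕ) (a' α τ κ L : ℝ) : ℝ :=
  co * d * (1 + α) * (κ ^ 2 * Real.exp (κ ^ 2 / 2)) + a' * co ^ 2 * (1 + τ) ^ 2 * (Real.cosh (κ * L) - 1)

omit [Fintype o] [DecidableEq o] [NeZero n] hM in
/-- `Jvec ≥ 0`. [folklore] -/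
theorem Jvec_nonneg (co d : ℕ) {a' α τ : ℝ} (ha' : 0 ≤ a') (hα : 0 ≤ α) (κ L : ℝ) : 0 ≤ Jvec co d a' α τ κ L := by
  have : 0 ≤ Real.cosh (κ * L) - 1 := by linarith [Real.one_le_cosh (κ * L)]
  unfold Jvec; positivity

omit [Fintype o] [DecidableEq o] [NeZero n] hM in
/-- `Jvec` vanishes at `κ = 0`. [folklore] -/
theorem Jvec_zero (co d : ℕ) (a' α τ L : ℝ) : Jvec co d a' α τ 0 L = 0 := by simp [Jvec]

variable {R : Fin d → (Tor (fine n M) × Fin d → Matrix o o ℂ)} {Γ : ContourSystem d n M} {a' α τ L : ℝ}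

/-- **ROW DEFECT OF `V_R`**: `defect_{κ, ρv}(vecOp n M a′ Γ R)(i) ≤ Jvec (card o) d a′ α τ κ L` — free of `n` and of the torus. [folklore] -/
theorem ctRowDefect_vecOp_le (ha' : 0 ≤ a') (hα : 0 ≤ α) (hτ : 0 ≤ τ) (hR : ∀ ν k, ‖connM (fine n M) ((n : ℕ) : ℂ) R ν k‖ ≤ α)
    (hT : ∀ y j μ (t : Fin n), ‖transport (fine n M) R μ (Γ y j μ t) - 1‖ ≤ τ)
    (hlip : ∀ x μ ν', |ρ (x + unitVec (fine n M) ν', μ) - ρ (x, μ)| ≤ 1 / n)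
    (hL : ∀ (y : Tor M) (μ : Fin d) (j j' : Fin d → Fin n) (t t' : Fin n),
      |ρ (bpt n M y j + tstep (fine n M) μ t, μ) - ρ (bpt n M y j' + tstep (fine n M) μ t', μ)| ≤ L)
    (i : (Tor (fine n M) × Fin d) × o) :
    ctRowDefect (vecOp n M a' Γ R) κ (rhoV n M ρ) i ≤ Jvec (Fintype.card o) d a' α τ κ L := by
  rw [vecOp, Jvec]
  refine (ctRowDefect_add_le _ _ κ _ i).trans (add_le_add ?_ ?_)
  · have h := ctRowDefect_covLapC_le n M (κ := κ) hα hR hlip i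
    linarith
  · have h := ctRowDefect_mass_le n M (κ := κ) ha' hτ hT hL i
    linarith

end Budget

end Summit.QuantumFields.BalabanUV.T4Continuum.CovariantVectorCTDefects

end
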